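import Summits.HodgeConjecture.CorCM.MumfordTateRankProductsOfCurves
import Summits.HodgeConjecture.CorCM.MumfordTateRankMultiplicities
import HarnessLib

/-!
# Multiplicities over a base do not change the Mumford–Tate rank: `t(A × ⨁_j R_{cls j}) = t(A × ⨁_q R_q)` for a surjective class map
# `cls : Fin (m+1) → Q`, and `t(⨁_j R_{cls j}) = t(⨁_q R_q)` (Moonen–Zarhin 1999 §1: `Hg` sees only the set of simple factors)

COR-CM (cell `pub-hodgecm2`, seat `b27` gen 51, count-neutral Mumford–Tate-rank ladder; theorems only, no definition, no named fact;
UNCONDITIONAL — nothing here uses or asserts HC_CM).  Notation `t(X) = dim MT(H¹X)`.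

The tree removes multiplicities in two shapes: a repeated factor next to a base, `t((A × B) × B) = t(A × B)` (`CorCM/MumfordTateRankDuplicateFactor`),
and a family with multiplicities `t(⨁_{(i,k) : Σ i, m_i} B_i) = t(⨁_i B_i)` (`CorCM/MumfordTateRankMultiplicities`).  The «any elliptic curves» theorems
of the ladder present a family with repetitions through a CLASS MAP — `X ∼ A × ⨁_j R (cls j)` with `cls : Fin (m + 1) → Q` onto a finite type of
representatives `R : Q → AV` (e.g. the isogeny classes of the curves, `CorCM/MumfordTateRankThree`) — and need the base `A` kept aside.  This file
supplies exactly that bookkeeping: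

* §1 **`mtRank_hodge_one_eq_of_isIsogenous_prod_biproduct_cls`** — `t(X) = t(X')` for `X ∼ A × ⨁_j R (cls j)`, `X' ∼ A × ⨁_q R q`, `cls`
  surjective, `0 < dim A` (ANY abelian varieties `R q`).  Induction on `m`, peeling the index `0`: if its class recurs among the later indices the
  factor `R (cls 0)` is a duplicate (`mtRank_hodge_one_eq_of_isIsogenous_prod_prod_self`); otherwise it joins the base, `A ↝ A × R (cls 0)`, and the
  class type shrinks to `{q // q ≠ cls 0}` (`isIsogenous_biproduct_prod_erase`).
* §2 **`mtRank_hodge_one_eq_of_isIsogenous_biproduct_cls`** — the base-free form `t(⨁_j R (cls j)) = t(⨁_q R q)`, read off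
  `CorCM/MumfordTateRankMultiplicities` through the fibre decomposition `Fin (m + 1) ≃ Σ q, cls⁻¹(q)` (`Equiv.sigmaFiberEquiv`).

## References
* [MoonenZarhin1999LowDim] B. Moonen, Yu. G. Zarhin, *Hodge classes on abelian varieties of low dimension*, Math. Ann. 315 (1999), §1 and §3 (3.1)
  [corpus: paper:arxiv-math_9901113 pp. 2, 6]. [cite: MoonenZarhin1999LowDim, §1 and §3]
* [Moonen1999MTNotes] B. Moonen, *Notes on Mumford–Tate groups* (1999), (1.8), (1.13). [cite: Moonen1999MTNotes, (1.8) and (1.13)]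
* [MumfordAV1970] D. Mumford, *Abelian Varieties* (1970), §19 Thm. 1 and Cor. 2. [cite: MumfordAV1970, §19 Thm. 1]
-/

noncomputable section

open CategoryTheory CategoryTheory.Limits Module
open scoped BigOperators

namespace Summit.HodgeConjecture.CorCM

open Literature.AlgebraicGeometry.Motives
open Literature.AlgebraicGeometry.Motives.AbelianVariety
open Literature.AlgebraicGeometry.Motives.HodgeStructure
open Literature.AlgebraicGeometry.HodgeTheory

variable [HodgeTensorFacts.{0, 0}]

/-! ## §1 Over a base `A` -/

/-- **`t(A × ⨁_j R_{cls j}) = t(A × ⨁_q R_q)` for a surjective class map `cls : Fin (m + 1) → Q`**: the Mumford–Tate rank of `H¹` over a base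
`A` (`0 < dim A`) depends only on WHICH factors `R q` occur, not how often (peel the index `0`: a recurring class is a duplicate factor,
`t((A' × B) × B) = t(A' × B)`; a class occurring once joins the base). [cite: MoonenZarhin1999LowDim, §1 and §3] [cite: Moonen1999MTNotes, (1.8) and (1.13)] -/
theorem mtRank_hodge_one_eq_of_isIsogenous_prod_biproduct_cls : ∀ {m : ℕ} {Q : Type} [Fintype Q] [DecidableEq Q]
    (R : Q → AbelianVariety ℂ) (cls : Fin (m + 1) → Q) (_ : Function.Surjective cls)
    {A X X' : AbelianVariety ℂ} {n n' : ℕ} (hX : IsSmoothProjective n X.X) (hX' : IsSmoothProjective n' X'.X) (_ : 0 < A.dim),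
    IsIsogenous X (A.prod (⨁ fun j => R (cls j))) → IsIsogenous X' (A.prod (⨁ R)) →
    haveI := BettiUniverse.finite hX 1
    haveI := BettiUniverse.finite hX' 1
    (BettiUniverse.hodge exists_isReal_hodgeModel_holds hX 1).mtRank = (BettiUniverse.hodge exists_isReal_hodgeModel_holds hX' 1).mtRank
  | 0, Q, _, _, R, cls, hcls, A, X, X', n, n', hX, hX', _, hXP, hX'P => by
    -- one index: both biproducts are the single factor `R (cls 0)`
    have hq : ∀ q, q = cls 0 := fun q => by
      obtain ⟨j, rfl⟩ := hcls q
      exact congrArg cls (Fin.ext (by have := j.2; omega))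
    have h₁ : IsIsogenous (⨁ fun j => R (cls j)) (R (cls 0)) :=
      isIsogenous_biproduct_of_forall_eq (fun j => R (cls j)) 0 fun j => Fin.ext (by have := j.2; omega)
    have h₂ : IsIsogenous (⨁ R) (R (cls 0)) := isIsogenous_biproduct_of_forall_eq R (cls 0) hq
    exact Literature.AlgebraicGeometry.Pohlmann1968.mtRank_hodge_one_eq_of_isIsogenous hX hX'
      ((hXP.trans ((IsIsogenous.refl A).prod h₁)).trans (hX'P.trans ((IsIsogenous.refl A).prod h₂)).symm')
  | m + 1, Q, _, _, R, cls, hcls, A, X, X', n, n', hX, hX', hA0, hXP, hX'P => by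
    classical
    haveI := BettiUniverse.finite hX 1
    haveI := BettiUniverse.finite hX' 1
    -- `⨁_j R (cls j) ≅ R (cls 0) × ⨁_j R (cls (succ j))`
    obtain ⟨h, g, hhg, hgh⟩ := AndreRiemann.biproduct_succ_split (fun j => R (cls j))
    have hh : IsIsogeny h := isIsogeny_of_comp_eq_of_comp_eq (isIsogeny_id _) (isIsogeny_id _) hgh hhg
    have hsplit : IsIsogenous (⨁ fun j => R (cls j)) ((R (cls 0)).prod (⨁ fun j : Fin (m + 1) => R (cls j.succ))) := ⟨h, hh⟩
    have hA : IsSmoothProjective (A.prod (⨁ fun j : Fin (m + 1) => R (cls j.succ))).dim (A.prod (⨁ fun j : Fin (m + 1) => R (cls j.succ))).X :=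
      AbelianVariety.isSmoothProjective_holds
    haveI := BettiUniverse.finite hA 1
    by_cases hdup : ∃ j : Fin (m + 1), cls j.succ = cls 0
    · -- the class of `0` recurs: `R (cls 0)` is a duplicate factor
      obtain ⟨j, hj⟩ := hdup
      have hcls' : Function.Surjective (fun i : Fin (m + 1) => cls i.succ) := by
        intro q
        obtain ⟨i, hi⟩ := hcls q
        refine Fin.cases ?_ (fun i' hi' => ⟨i', hi'⟩) i hi
        intro h0
        exact ⟨j, hj.trans h0⟩
      -- `A × ⨁_{i} R(cls (succ i)) ∼ (A × ⨁_{i ≠ j}) × R (cls (succ j))`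
      have herase := isIsogenous_biproduct_prod_erase (fun i : Fin (m + 1) => R (cls i.succ)) j
      have hbase : IsIsogenous (A.prod (⨁ fun i : Fin (m + 1) => R (cls i.succ)))
          ((A.prod (⨁ fun i : {i // i ≠ j} => R (cls i.1.succ))).prod (R (cls j.succ))) :=
        ((IsIsogenous.refl A).prod herase).trans
          (Literature.AlgebraicGeometry.HodgeTheory.isIsogenous_prod_assoc A _ (R (cls j.succ))).symm'
      have hXQ : IsIsogenous X (((A.prod (⨁ fun i : {i // i ≠ j} => R (cls i.1.succ))).prod (R (cls j.succ))).prod (R (cls j.succ))) := by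
        have h1 : IsIsogenous X ((A.prod (⨁ fun i : Fin (m + 1) => R (cls i.succ))).prod (R (cls 0))) :=
          (hXP.trans ((IsIsogenous.refl A).prod (hsplit.trans (isIsogenous_prod_comm _ _)))).trans
            (Literature.AlgebraicGeometry.HodgeTheory.isIsogenous_prod_assoc A _ (R (cls 0))).symm'
        rw [← hj] at h1
        exact h1.trans (hbase.prod (IsIsogenous.refl _))
      have h0 : 0 < ((A.prod (⨁ fun i : {i // i ≠ j} => R (cls i.1.succ))).prod (R (cls j.succ))).dim := by
        rw [dim_prod, dim_prod]; omega
      have hdq := mtRank_hodge_one_eq_of_isIsogenous_prod_prod_self hX hA h0 hXQ hbase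
      rw [hdq]
      exact mtRank_hodge_one_eq_of_isIsogenous_prod_biproduct_cls R (fun i : Fin (m + 1) => cls i.succ) hcls' hA hX' hA0
        (IsIsogenous.refl _) hX'P
    · -- the class of `0` occurs once: it joins the base
      push Not at hdup
      let Q' := {q // q ≠ cls 0}
      let cls' : Fin (m + 1) → Q' := fun i => ⟨cls i.succ, hdup i⟩
      have hcls' : Function.Surjective cls' := by
        rintro ⟨q, hq⟩
        obtain ⟨i, hi⟩ := hcls q
        refine Fin.cases ?_ (fun i' hi' => ⟨i', Subtype.ext hi'⟩) i hi
        intro h0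
        exact absurd h0.symm hq
      have hB : IsSmoothProjective ((A.prod (R (cls 0))).prod (⨁ fun q : Q' => R q.1)).dim ((A.prod (R (cls 0))).prod (⨁ fun q : Q' => R q.1)).X :=
        AbelianVariety.isSmoothProjective_holds
      haveI := BettiUniverse.finite hB 1
      have hXQ : IsIsogenous X ((A.prod (R (cls 0))).prod (⨁ fun i => (fun q : Q' => R q.1) (cls' i))) :=
        (hXP.trans ((IsIsogenous.refl A).prod hsplit)).trans
          (Literature.AlgebraicGeometry.HodgeTheory.isIsogenous_prod_assoc A (R (cls 0)) _).symm'
      have hrec := mtRank_hodge_one_eq_of_isIsogenous_prod_biproduct_cls (fun q : Q' => R q.1) cls' hcls' hX hB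
        (by rw [dim_prod]; omega) hXQ (IsIsogenous.refl _)
      rw [hrec]
      -- `A × ⨁_q R q ∼ (A × R (cls 0)) × ⨁_{q ≠ cls 0} R q`
      refine (Literature.AlgebraicGeometry.Pohlmann1968.mtRank_hodge_one_eq_of_isIsogenous hX' hB ?_).symm
      exact (hX'P.trans ((IsIsogenous.refl A).prod ((isIsogenous_biproduct_prod_erase R (cls 0)).trans (isIsogenous_prod_comm _ _)))).trans
        (Literature.AlgebraicGeometry.HodgeTheory.isIsogenous_prod_assoc A (R (cls 0)) _).symm'

/-! ## §2 Without a base -/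

omit [HodgeTensorFacts.{0, 0}] in
/-- **`⨁_j R_{cls j} ≅ ⨁_{(q, j) : Σ q, cls⁻¹ q} R_q`** (re-indexing along `Equiv.sigmaFiberEquiv`). [cite: MumfordAV1970, §19 Thm. 1] -/
theorem isIsogenous_biproduct_cls_sigma {m : ℕ} {Q : Type} [Fintype Q] [DecidableEq Q] (R : Q → AbelianVariety ℂ) (cls : Fin (m + 1) → Q) :
    IsIsogenous (⨁ fun j => R (cls j)) (⨁ fun p : Σ q, {j // cls j = q} => R p.1) := by
  classical
  let e : (Σ q, {j // cls j = q}) ≃ Fin (m + 1) := Equiv.sigmaFiberEquiv cls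
  let i₁ : (⨁ ((fun j => R (cls j)) ∘ e)) ≅ ⨁ fun j => R (cls j) := biproduct.reindex e (fun j => R (cls j))
  let i₂ : (⨁ ((fun j => R (cls j)) ∘ e)) ≅ ⨁ fun p : Σ q, {j // cls j = q} => R p.1 :=
    biproduct.mapIso fun p => eqToIso (by change R (cls p.2.1) = R p.1; rw [p.2.2])
  exact ⟨i₁.inv ≫ i₂.hom, isIsogeny_hom_of_iso (i₁.symm ≪≫ i₂)⟩

/-- **`t(⨁_j R_{cls j}) = t(⨁_q R_q)` for a surjective class map `cls : Fin (m + 1) → Q`** (some `R q` of positive dimension): the base-free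
form, from `CorCM/MumfordTateRankMultiplicities` along the fibre decomposition of the index set. [cite: MoonenZarhin1999LowDim, §1]
[cite: Moonen1999MTNotes, (1.8)] -/
theorem mtRank_hodge_one_eq_of_isIsogenous_biproduct_cls {m : ℕ} {Q : Type} [Fintype Q] [DecidableEq Q] (R : Q → AbelianVariety ℂ)
    (cls : Fin (m + 1) → Q) (hcls : Function.Surjective cls) (hR : ∀ q, 0 < (R q).dim)
    {X X' : AbelianVariety ℂ} {n n' : ℕ} (hX : IsSmoothProjective n X.X) (hX' : IsSmoothProjective n' X'.X)
    (hXP : IsIsogenous X (⨁ fun j => R (cls j))) (hX'P : IsIsogenous X' (⨁ R)) :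
    haveI := BettiUniverse.finite hX 1
    haveI := BettiUniverse.finite hX' 1
    (BettiUniverse.hodge exists_isReal_hodgeModel_holds hX 1).mtRank = (BettiUniverse.hodge exists_isReal_hodgeModel_holds hX' 1).mtRank := by
  classical
  haveI : ∀ q, Nonempty {j // cls j = q} := fun q => by obtain ⟨j, hj⟩ := hcls q; exact ⟨⟨j, hj⟩⟩
  haveI : Nonempty Q := ⟨cls 0⟩
  have hX0 : 0 < X.dim := by
    obtain ⟨f, hf⟩ := hXP
    rw [dim_eq_of_isIsogeny hf, AndreRiemann.dim_biproduct_fin]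
    exact Finset.sum_pos (fun j _ => hR _) Finset.univ_nonempty
  have hX'0 : 0 < X'.dim := by
    obtain ⟨f, hf⟩ := hX'P
    let i : (⨁ (R ∘ (Fintype.equivFin Q).symm)) ≅ ⨁ R := biproduct.reindex (Fintype.equivFin Q).symm R
    haveI : Nonempty (Fin (Fintype.card Q)) := ⟨Fintype.equivFin Q (cls 0)⟩
    rw [dim_eq_of_isIsogeny hf, dim_eq_of_isIsogeny (isIsogeny_hom_of_iso i.symm), AndreRiemann.dim_biproduct_fin]
    exact Finset.sum_pos (fun j _ => hR _) Finset.univ_nonempty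
  exact mtRank_hodge_one_eq_of_isIsogenous_biproduct_sigma (m := fun q => {j // cls j = q}) (B := R) hX hX' hX0 hX'0
    (hXP.trans (isIsogenous_biproduct_cls_sigma R cls)) hX'P

end Summit.HodgeConjecture.CorCM

end
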